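import Mathlib

/-!
# `MatrixDescartes` (stmt-ValiantsHypothesis-18050) — POLE WEAVING, the calculus:
# `(1 − x)·Σᵢ 8nᵢ x^{nᵢ} − x²` alternates in sign along `2c + 1` explicit points of `(1/2, 1)`

HONEST FRAMING.  Cell `pub-symmetroid`, seat `val-sym-mdr-p2` (gen 24); helper file `--supports` the crux
`Theses.LacunarySymmetroid.MatrixDescartes` (OPEN), NO closure claim.  Pure real-analysis half of the companion
`…PivotStaircaseAllK` (which turns it into «`Z₊ ≥ 2K` at `(2, K)`, index one, for EVERY `K`» and `RankOneStaircase`):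
with `S = 2^{c+7}`, `nᵢ = (S²)^{i+1}` and `g(x) = (1 − x)·Σ_{i<c} 8nᵢ x^{nᵢ} − x²`,
* PEAKS `g(1 − 1/(2nᵢ)) > 0` (`g_peak_pos`: Bernoulli `(1 − 1/(2n))ⁿ ≥ 1/2` makes the `i`-th bump `≥ 2 > x²`);
* VALLEYS `g(1/2) < 0`, `g(1 − 1/(S nᵢ)) < 0` (`g_half_neg`, `g_valley_neg`: every bump is `≤ 1/(8(c+1))` — passed bumps by
  the factor `1 − x = 1/(S nᵢ)`, coming bumps by `(1 − 1/N)^{N L} ≤ e^{−L} ≤ 2/L²` with `L ≥ S ≥ 128(c+1)`);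
* the `2c + 1` points `1/2 < 1 − 1/(2n₀) < 1 − 1/(S n₀) < 1 − 1/(2n₁) < ⋯ < 1 − 1/(S n_{c−1})` increase and carry the signs
  `−,+,−,…,+,−` (`ω_succ_lt`, `g_alternates`).
Nothing here bears on `MatrixDescartes` in its window, the upper pivot rungs, `DoorA26`/`DoorA34`, the registers, `VP ≠ VNP`.
[folklore] Bernoulli's inequality (`one_add_mul_le_pow`), `(1 − t/n)ⁿ ≤ e^{−t}` (`Real.one_sub_div_pow_le_exp_neg`),
`1 + x + x²/2 ≤ eˣ` (`Real.quadratic_le_exp_of_nonneg`).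
-/

set_option linter.dupNamespace false

namespace Summit.ValiantsHypothesis.ValiantsHypothesis.Theorems.LacunarySymmetroidMatrixDescartes.Pivot.PoleWeave

open scoped BigOperators
open Finset

/-! ### 0. Parameters: `S = 2^{c+7}`, `M = S²`, exponents `nᵢ = M^{i+1}` -/

/-- The scale `S = 2^{c+7}` (local notation, no definition; a numeral expression, so `ℕ`- or `ℝ`-valued by context). -/
local notation3 (prettyPrint := false) "S⟦" c "⟧" => (2 ^ (c + 7))

/-- The exponents `nᵢ = (S²)^{i+1}` (local notation, no definition). -/
local notation3 (prettyPrint := false) "n⟦" c ", " i "⟧" => ((S⟦c⟧ * S⟦c⟧) ^ (i + 1))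

/-- The closed form `g(t) = (1 − t)·Σᵢ 8nᵢ t^{nᵢ} − t²` of the slack-free determinant (local notation, no definition). -/
local notation3 (prettyPrint := false) "g⟦" c "⟧(" t ")" =>
  ((1 - t) * (∑ i : Fin c, (8 * (n⟦c, (i : ℕ)⟧ : ℝ)) * t ^ (n⟦c, (i : ℕ)⟧)) - t ^ 2)

/-- `S = 2^{c+7} ≥ 128(c+1)`. [folklore] -/
theorem S_ge (c : ℕ) : 128 * (c + 1) ≤ (S⟦c⟧ : ℕ) := by
  have h : c < 2 ^ c := Nat.lt_two_pow_self
  have : (2 : ℕ) ^ (c + 7) = 128 * 2 ^ c := by rw [pow_add]; ring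
  rw [this]
  exact Nat.mul_le_mul_left 128 h

/-- `1 ≤ S`. -/
theorem one_le_S (c : ℕ) : 1 ≤ (S⟦c⟧ : ℕ) := Nat.one_le_two_pow
/-- `S` is even: `S = 2 · 2^{c+6}`. -/
theorem S_eq_two_mul (c : ℕ) : (S⟦c⟧ : ℕ) = 2 * 2 ^ (c + 6) := by
  rw [pow_succ]; ring

/-- `S ≤ nᵢ`. -/
theorem S_le_n (c i : ℕ) : (S⟦c⟧ : ℕ) ≤ n⟦c, i⟧ := by
  have h1 : 1 ≤ (S⟦c⟧ : ℕ) := one_le_S c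
  calc (S⟦c⟧ : ℕ) = S⟦c⟧ * 1 := (mul_one _).symm
    _ ≤ S⟦c⟧ * S⟦c⟧ := Nat.mul_le_mul_left _ h1
    _ = (S⟦c⟧ * S⟦c⟧) ^ 1 := (pow_one _).symm
    _ ≤ (S⟦c⟧ * S⟦c⟧) ^ (i + 1) := Nat.pow_le_pow_right (Nat.mul_pos h1 h1) (by omega)

/-- `S² ≤ nᵢ`. -/
theorem SS_le_n (c i : ℕ) : (S⟦c⟧ * S⟦c⟧ : ℕ) ≤ n⟦c, i⟧ := by
  have h1 : 1 ≤ (S⟦c⟧ : ℕ) := one_le_S c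
  calc (S⟦c⟧ * S⟦c⟧ : ℕ) = (S⟦c⟧ * S⟦c⟧) ^ 1 := (pow_one _).symm
    _ ≤ (S⟦c⟧ * S⟦c⟧) ^ (i + 1) := Nat.pow_le_pow_right (Nat.mul_pos h1 h1) (by omega)

/-- `1 ≤ nᵢ`. -/
theorem one_le_n (c i : ℕ) : 1 ≤ (n⟦c, i⟧ : ℕ) := (one_le_S c).trans (S_le_n c i)

/-- The exponents increase: `nᵢ ≤ nⱼ` for `i ≤ j`. -/
theorem n_mono (c : ℕ) {i j : ℕ} (hij : i ≤ j) : (n⟦c, i⟧ : ℕ) ≤ n⟦c, j⟧ :=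
  Nat.pow_le_pow_right (Nat.mul_pos (one_le_S c) (one_le_S c)) (by omega)

/-- The next exponent is `S²` times the previous one: `n_{i+1} = S · (S · nᵢ)`. -/
theorem n_succ (c i : ℕ) : (n⟦c, i + 1⟧ : ℕ) = S⟦c⟧ * (S⟦c⟧ * n⟦c, i⟧) := by
  rw [pow_succ]; ring

/-- Factorisation of a later exponent through an earlier valley scale: for `b < j`,
`nⱼ = (S · n_b) · (S · M^{j − b − 1})`. -/
theorem n_factor (c : ℕ) {b j : ℕ} (hbj : b < j) :
    (n⟦c, j⟧ : ℕ) = (S⟦c⟧ * n⟦c, b⟧) * (S⟦c⟧ * (S⟦c⟧ * S⟦c⟧) ^ (j - b - 1)) := by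
  have hj : j + 1 = (b + 1) + 1 + (j - b - 1) := by omega
  rw [hj, pow_add, pow_succ]
  ring

/-- Every exponent is even: `nⱼ = 2 · (2^{c+6} · S · M^{j})`. -/
theorem n_eq_two_mul (c j : ℕ) : (n⟦c, j⟧ : ℕ) = 2 * (2 ^ (c + 6) * S⟦c⟧ * (S⟦c⟧ * S⟦c⟧) ^ j) := by
  rw [pow_succ, S_eq_two_mul]; ring

/-! ### 1. Elementary inequalities -/

/-- Bernoulli at the peak: `(1 − 1/(2n))ⁿ ≥ 1/2` for every natural `n ≥ 1`. [folklore] -/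
theorem half_le_peak_pow (n : ℕ) (hn : 1 ≤ n) : (1 : ℝ) / 2 ≤ (1 - 1 / (2 * (n : ℝ))) ^ n := by
  have hn' : (0 : ℝ) < n := by exact_mod_cast hn
  have hB := one_add_mul_le_pow (a := -(1 / (2 * (n : ℝ)))) (by
    have : 0 < 1 / (2 * (n : ℝ)) := by positivity
    have h1n : (1 : ℝ) ≤ n := by exact_mod_cast hn
    have : 1 / (2 * (n : ℝ)) ≤ 1 / 2 := by
      rw [div_le_div_iff₀ (by positivity) (by norm_num)]; linarith
    linarith) n
  have h2 : (1 : ℝ) + (n : ℝ) * -(1 / (2 * (n : ℝ))) = 1 / 2 := by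
    field_simp; ring
  rw [h2] at hB
  simpa [sub_eq_add_neg] using hB

/-- A decaying bump: for naturals `N ≥ 1`, `L ≥ 1`, `8 · (N L) · (1 − 1/N)^{N L} / N ≤ 16 / L`
(`(1 − 1/N)^N ≤ e^{−1}` and `e^{L} ≥ L²/2`). [folklore] -/
theorem bump_tail_le (N L : ℕ) (hN : 1 ≤ N) (hL : 1 ≤ L) :
    8 * ((N * L : ℕ) : ℝ) * (1 - 1 / (N : ℝ)) ^ (N * L) * (1 / (N : ℝ)) ≤ 16 / (L : ℝ) := by
  have hN' : (0 : ℝ) < N := by exact_mod_cast hN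
  have hL' : (0 : ℝ) < L := by exact_mod_cast hL
  have h0 : (0 : ℝ) ≤ 1 - 1 / (N : ℝ) := by
    rw [sub_nonneg, div_le_one hN']; exact_mod_cast hN
  -- `(1 − 1/N)^N ≤ e^{−1}`
  have hexp1 : (1 - 1 / (N : ℝ)) ^ N ≤ Real.exp (-1) :=
    Real.one_sub_div_pow_le_exp_neg (t := 1) (n := N) (by exact_mod_cast hN)
  -- hence `(1 − 1/N)^{N L} ≤ e^{−L}`
  have hpow : (1 - 1 / (N : ℝ)) ^ (N * L) ≤ Real.exp (-(L : ℝ)) := by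
    rw [pow_mul]
    calc ((1 - 1 / (N : ℝ)) ^ N) ^ L ≤ (Real.exp (-1)) ^ L := pow_le_pow_left₀ (pow_nonneg h0 N) hexp1 L
      _ = Real.exp (-(L : ℝ)) := by rw [← Real.exp_nat_mul]; ring_nf
  -- and `e^{−L} ≤ 2/L²` from `e^{L} ≥ 1 + L + L²/2 ≥ L²/2`
  have hq : ((L : ℝ)) ^ 2 / 2 ≤ Real.exp (L : ℝ) := by
    have := Real.quadratic_le_exp_of_nonneg (x := (L : ℝ)) hL'.le
    linarith
  have hexpL : Real.exp (-(L : ℝ)) ≤ 2 / (L : ℝ) ^ 2 := by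
    rw [Real.exp_neg]
    rw [inv_le_comm₀ (Real.exp_pos _) (by positivity)]
    calc (2 / (L : ℝ) ^ 2)⁻¹ = (L : ℝ) ^ 2 / 2 := by rw [inv_div]
      _ ≤ Real.exp (L : ℝ) := hq
  calc 8 * ((N * L : ℕ) : ℝ) * (1 - 1 / (N : ℝ)) ^ (N * L) * (1 / (N : ℝ))
      ≤ 8 * ((N * L : ℕ) : ℝ) * (2 / (L : ℝ) ^ 2) * (1 / (N : ℝ)) := by
        apply mul_le_mul_of_nonneg_right _ (by positivity)
        exact mul_le_mul_of_nonneg_left (hpow.trans hexpL) (by positivity)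
    _ = 16 / (L : ℝ) := by
        push_cast
        field_simp
        norm_num

/-! ### 2. Signs of the closed form at the weaving points -/

/-- **Peaks.**  At `x = 1 − 1/(2nᵢ)` the closed form is positive: the `i`-th bump alone is `≥ 2 > x²`. -/
theorem g_peak_pos (c : ℕ) (i : ℕ) (hi : i < c) :
    0 < g⟦c⟧(1 - 1 / (2 * (n⟦c, i⟧ : ℝ))) := by
  set x : ℝ := 1 - 1 / (2 * (n⟦c, i⟧ : ℝ)) with hx
  have hn1 : 1 ≤ n⟦c, i⟧ := one_le_n c i
  have hn' : (0 : ℝ) < (n⟦c, i⟧ : ℝ) := by exact_mod_cast hn1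
  have hx0 : 0 ≤ x := by
    rw [hx, sub_nonneg, div_le_one (by positivity)]
    have : (1 : ℝ) ≤ (n⟦c, i⟧ : ℝ) := by exact_mod_cast hn1
    linarith
  have hx1 : x ≤ 1 := by
    have : 0 < 1 / (2 * (n⟦c, i⟧ : ℝ)) := by positivity
    rw [hx]; linarith
  have hx2 : x ^ 2 ≤ 1 := pow_le_one₀ hx0 hx1
  have h1x : 1 - x = 1 / (2 * (n⟦c, i⟧ : ℝ)) := by rw [hx]; ring
  -- the `i`-th bump: `(1 − x) · 8nᵢ · x^{nᵢ} ≥ (1/(2nᵢ)) · 8nᵢ · (1/2) = 2`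
  have hterm : 2 ≤ (1 - x) * ((8 * (n⟦c, i⟧ : ℝ)) * x ^ (n⟦c, i⟧)) := by
    have hb : (1 : ℝ) / 2 ≤ x ^ (n⟦c, i⟧) := by
      have := half_le_peak_pow (n⟦c, i⟧) hn1
      rw [hx]; convert this using 2; push_cast; ring
    rw [h1x]
    have : (1 / (2 * (n⟦c, i⟧ : ℝ))) * ((8 * (n⟦c, i⟧ : ℝ)) * x ^ (n⟦c, i⟧)) = 4 * x ^ (n⟦c, i⟧) := by
      field_simp; ring
    rw [this]; linarith
  -- the other bumps are nonnegative
  have hsum : (8 * (n⟦c, i⟧ : ℝ)) * x ^ (n⟦c, i⟧)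
      ≤ ∑ j : Fin c, (8 * (n⟦c, (j : ℕ)⟧ : ℝ)) * x ^ (n⟦c, (j : ℕ)⟧) := by
    have := Finset.single_le_sum (s := (Finset.univ : Finset (Fin c)))
      (f := fun j : Fin c => (8 * (n⟦c, (j : ℕ)⟧ : ℝ)) * x ^ (n⟦c, (j : ℕ)⟧))
      (fun j _ => by positivity) (Finset.mem_univ ⟨i, hi⟩)
    simpa using this
  have h1x0 : 0 ≤ 1 - x := by linarith
  have := mul_le_mul_of_nonneg_left hsum h1x0
  linarith

/-- **Bumps at `1/2`.**  Every bump `(1 − x)·8nⱼ x^{nⱼ}` is `≤ 1/(8(c+1))` at `x = 1/2` (the case `N = 2` of `bump_tail_le`,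
`nⱼ = 2L`), so their sum is `≤ c/(8(c+1))`. -/
theorem bumps_half_le (c : ℕ) :
    (1 - (1 : ℝ) / 2) * ∑ j : Fin c, (8 * (n⟦c, (j : ℕ)⟧ : ℝ)) * ((1 : ℝ) / 2) ^ (n⟦c, (j : ℕ)⟧)
      ≤ (c : ℝ) * (1 / (8 * ((c : ℝ) + 1))) := by
  have hS := S_ge c
  have hS1 := one_le_S c
  have hterm : ∀ j : Fin c, (1 - (1 : ℝ) / 2) * ((8 * (n⟦c, (j : ℕ)⟧ : ℝ)) * ((1 : ℝ) / 2) ^ (n⟦c, (j : ℕ)⟧))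
      ≤ 1 / (8 * ((c : ℝ) + 1)) := by
    intro j
    set L : ℕ := 2 ^ (c + 6) * S⟦c⟧ * (S⟦c⟧ * S⟦c⟧) ^ (j : ℕ) with hL
    have hnj : (n⟦c, (j : ℕ)⟧ : ℕ) = 2 * L := by rw [hL]; exact n_eq_two_mul c j
    have hLS : (S⟦c⟧ : ℕ) ≤ L := by
      rw [hL]
      calc (S⟦c⟧ : ℕ) = 1 * S⟦c⟧ * 1 := by ring
        _ ≤ 2 ^ (c + 6) * S⟦c⟧ * (S⟦c⟧ * S⟦c⟧) ^ (j : ℕ) :=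
          Nat.mul_le_mul (Nat.mul_le_mul_right _ Nat.one_le_two_pow) (Nat.one_le_pow _ _ (Nat.mul_pos hS1 hS1))
    have hL1 : 1 ≤ L := hS1.trans hLS
    have hL' : (128 : ℝ) * ((c : ℝ) + 1) ≤ (L : ℝ) := by exact_mod_cast hS.trans hLS
    have htail := bump_tail_le 2 L (by norm_num) hL1
    have hnjR : (8 * (n⟦c, (j : ℕ)⟧ : ℝ)) = 8 * ((2 * L : ℕ) : ℝ) := by
      rw [← hnj]; push_cast; ring
    calc (1 - (1 : ℝ) / 2) * ((8 * (n⟦c, (j : ℕ)⟧ : ℝ)) * ((1 : ℝ) / 2) ^ (n⟦c, (j : ℕ)⟧))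
        = 8 * ((2 * L : ℕ) : ℝ) * (1 - 1 / ((2 : ℕ) : ℝ)) ^ (2 * L) * (1 / ((2 : ℕ) : ℝ)) := by
          rw [hnjR, hnj]; push_cast; ring
      _ ≤ 16 / (L : ℝ) := htail
      _ ≤ 16 / ((128 : ℝ) * ((c : ℝ) + 1)) := div_le_div_of_nonneg_left (by norm_num) (by positivity) hL'
      _ = 1 / (8 * ((c : ℝ) + 1)) := by field_simp; ring
  rw [Finset.mul_sum]
  have := Finset.sum_le_card_nsmul (Finset.univ : Finset (Fin c)) _ _ (fun j _ => hterm j)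
  simpa using this

/-- `c/(8(c+1)) < 1/8`. -/
theorem frac_lt_eighth (c : ℕ) : (c : ℝ) * (1 / (8 * ((c : ℝ) + 1))) < 1 / 8 := by
  have hc0 : (0 : ℝ) ≤ c := Nat.cast_nonneg c
  rw [show (c : ℝ) * (1 / (8 * ((c : ℝ) + 1))) = (c : ℝ) / (8 * ((c : ℝ) + 1)) by ring,
    div_lt_iff₀ (by positivity)]
  nlinarith

/-- **The valley at `1/2`.**  The closed form is negative there. -/
theorem g_half_neg (c : ℕ) : g⟦c⟧((1 : ℝ) / 2) < 0 := by
  have h1 := bumps_half_le c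
  have h2 := frac_lt_eighth c
  have h3 : ((1 : ℝ) / 2) ^ 2 = 1 / 4 := by norm_num
  rw [h3]
  linarith

/-- **Bumps at the valleys `1 − 1/(S n_b)`.**  Passed bumps (`j ≤ b`) are killed by the factor `1 − x = 1/(S n_b)`,
coming bumps (`j > b`) by `(1 − 1/N)^{N L} ≤ e^{−L} ≤ 2/L²`, `L ≥ S`; every bump is `≤ 1/(8(c+1))`, their sum `≤ c/(8(c+1))`. -/
theorem bumps_valley_le (c : ℕ) (b : ℕ) :
    (1 - (1 - 1 / ((S⟦c⟧ * n⟦c, b⟧ : ℕ) : ℝ)))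
        * ∑ j : Fin c, (8 * (n⟦c, (j : ℕ)⟧ : ℝ)) * (1 - 1 / ((S⟦c⟧ * n⟦c, b⟧ : ℕ) : ℝ)) ^ (n⟦c, (j : ℕ)⟧)
      ≤ (c : ℝ) * (1 / (8 * ((c : ℝ) + 1))) := by
  have hS := S_ge c
  have hS1 := one_le_S c
  set N : ℕ := S⟦c⟧ * n⟦c, b⟧ with hN
  have hN1 : 1 ≤ N := Nat.mul_pos hS1 (one_le_n c b)
  have hN' : (0 : ℝ) < N := by exact_mod_cast hN1
  set x : ℝ := 1 - 1 / (N : ℝ) with hx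
  have hx0 : 0 ≤ x := by
    rw [hx, sub_nonneg, div_le_one hN']; exact_mod_cast hN1
  have hx1 : x ≤ 1 := by
    have : 0 < 1 / (N : ℝ) := by positivity
    rw [hx]; linarith
  have h1x : 1 - x = 1 / (N : ℝ) := by rw [hx]; ring
  -- every bump is at most `1/(8(c+1))`
  have hterm : ∀ j : Fin c, (1 - x) * ((8 * (n⟦c, (j : ℕ)⟧ : ℝ)) * x ^ (n⟦c, (j : ℕ)⟧))
      ≤ 1 / (8 * ((c : ℝ) + 1)) := by
    intro j
    rcases (le_or_gt (j : ℕ) b) with hjb | hjb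
    · -- passed bump: `x^{n_j} ≤ 1` and `(1/N) · 8 n_j ≤ 8 n_b/(S n_b) = 8/S ≤ 1/(16(c+1))`
      have hnj : (n⟦c, (j : ℕ)⟧ : ℝ) ≤ (n⟦c, b⟧ : ℝ) := by exact_mod_cast n_mono c hjb
      have hxn : x ^ (n⟦c, (j : ℕ)⟧) ≤ 1 := pow_le_one₀ hx0 hx1
      have hnb : (0 : ℝ) < (n⟦c, b⟧ : ℝ) := by exact_mod_cast one_le_n c b
      have hS' : (128 : ℝ) * ((c : ℝ) + 1) ≤ (S⟦c⟧ : ℝ) := by exact_mod_cast hS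
      calc (1 - x) * ((8 * (n⟦c, (j : ℕ)⟧ : ℝ)) * x ^ (n⟦c, (j : ℕ)⟧))
          ≤ (1 - x) * ((8 * (n⟦c, b⟧ : ℝ)) * 1) := by
            apply mul_le_mul_of_nonneg_left _ (by rw [h1x]; positivity)
            exact mul_le_mul (by linarith) hxn (pow_nonneg hx0 _) (by positivity)
        _ = 8 / (S⟦c⟧ : ℝ) := by
            rw [h1x, hN]; push_cast; field_simp
        _ ≤ 8 / ((128 : ℝ) * ((c : ℝ) + 1)) := div_le_div_of_nonneg_left (by norm_num) (by positivity) hS'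
        _ = 1 / (16 * ((c : ℝ) + 1)) := by field_simp; ring
        _ ≤ 1 / (8 * ((c : ℝ) + 1)) := by
            apply div_le_div_of_nonneg_left (by norm_num) (by positivity); nlinarith
    · -- coming bump: `n_j = N · L` with `L = S · M^{j−b−1} ≥ S ≥ 128(c+1)`
      set L : ℕ := S⟦c⟧ * (S⟦c⟧ * S⟦c⟧) ^ ((j : ℕ) - b - 1) with hL
      have hnj : n⟦c, (j : ℕ)⟧ = N * L := by rw [hN, hL]; exact n_factor c hjb
      have hLS : S⟦c⟧ ≤ L := by
        rw [hL]; exact Nat.le_mul_of_pos_right _ (pow_pos (Nat.mul_pos hS1 hS1) _)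
      have hL1 : 1 ≤ L := hS1.trans hLS
      have hL' : (128 : ℝ) * ((c : ℝ) + 1) ≤ (L : ℝ) := by exact_mod_cast hS.trans hLS
      have hLpos : (0 : ℝ) < L := by exact_mod_cast hL1
      have htail : 8 * ((N * L : ℕ) : ℝ) * x ^ (N * L) * (1 / (N : ℝ)) ≤ 16 / (L : ℝ) := by
        rw [hx]; exact bump_tail_le N L hN1 hL1
      have hnjR : (8 * (n⟦c, (j : ℕ)⟧ : ℝ)) = 8 * ((N * L : ℕ) : ℝ) := by
        rw [← hnj]; push_cast; ring
      calc (1 - x) * ((8 * (n⟦c, (j : ℕ)⟧ : ℝ)) * x ^ (n⟦c, (j : ℕ)⟧))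
          = 8 * ((N * L : ℕ) : ℝ) * x ^ (N * L) * (1 / (N : ℝ)) := by
            rw [h1x, hnjR, hnj]; ring
        _ ≤ 16 / (L : ℝ) := htail
        _ ≤ 16 / ((128 : ℝ) * ((c : ℝ) + 1)) := div_le_div_of_nonneg_left (by norm_num) (by positivity) hL'
        _ = 1 / (8 * ((c : ℝ) + 1)) := by field_simp; ring
  rw [Finset.mul_sum]
  have := Finset.sum_le_card_nsmul (Finset.univ : Finset (Fin c)) _ _ (fun j _ => hterm j)
  simpa using this

/-- The valley points lie in `[1/2, 1]`. -/
theorem half_le_valley (c b : ℕ) :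
    (1 : ℝ) / 2 ≤ 1 - 1 / ((S⟦c⟧ * n⟦c, b⟧ : ℕ) : ℝ) ∧ 1 - 1 / ((S⟦c⟧ * n⟦c, b⟧ : ℕ) : ℝ) ≤ 1 := by
  have hS := S_ge c
  have hS1 := one_le_S c
  have h2 : (2 : ℝ) ≤ ((S⟦c⟧ * n⟦c, b⟧ : ℕ) : ℝ) := by
    have : (2 : ℕ) ≤ S⟦c⟧ * n⟦c, b⟧ :=
      le_trans (by omega) (hS.trans ((S_le_n c b).trans (Nat.le_mul_of_pos_left _ hS1)))
    exact_mod_cast this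
  have hpos : (0 : ℝ) < 1 / ((S⟦c⟧ * n⟦c, b⟧ : ℕ) : ℝ) := by positivity
  have hle : 1 / ((S⟦c⟧ * n⟦c, b⟧ : ℕ) : ℝ) ≤ 1 / 2 :=
    div_le_div_of_nonneg_left (by norm_num) (by norm_num) h2
  constructor <;> linarith

/-- **The valleys `1 − 1/(S n_b)`.**  The closed form is negative there. -/
theorem g_valley_neg (c : ℕ) (b : ℕ) :
    g⟦c⟧(1 - 1 / ((S⟦c⟧ * n⟦c, b⟧ : ℕ) : ℝ)) < 0 := by
  have h1 := bumps_valley_le c b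
  have h2 := frac_lt_eighth c
  obtain ⟨h3, -⟩ := half_le_valley c b
  have h4 : (1 : ℝ) / 4 ≤ (1 - 1 / ((S⟦c⟧ * n⟦c, b⟧ : ℕ) : ℝ)) ^ 2 := by nlinarith
  linarith

/-! ### 3. The weaving points `1/2 < 1 − 1/(2n₀) < 1 − 1/(S n₀) < 1 − 1/(2n₁) < ⋯` -/

/-- The gaps `ω_j = 1 − τ_j` of the weaving points: `ω₀ = 1/2`, `ω_{2i+1} = 1/(2nᵢ)` (peaks), `ω_{2i+2} = 1/(S nᵢ)`
(valleys) (local notation, no definition). -/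
local notation3 (prettyPrint := false) "ω⟦" c ", " j "⟧" =>
  (if j = 0 then ((1 : ℝ) / 2)
    else if j % 2 = 1 then (1 : ℝ) / (2 * (n⟦c, j / 2⟧ : ℝ))
    else (1 : ℝ) / ((S⟦c⟧ * n⟦c, j / 2 - 1⟧ : ℕ) : ℝ))

/-- `ω₀ = 1/2`. -/
theorem ω_zero (c : ℕ) : ω⟦c, 0⟧ = (1 : ℝ) / 2 := by simp

/-- `ω_{2i+1} = 1/(2nᵢ)`. -/
theorem ω_odd (c i : ℕ) : ω⟦c, 2 * i + 1⟧ = 1 / (2 * (n⟦c, i⟧ : ℝ)) := by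
  have h1 : (2 * i + 1) % 2 = 1 := by omega
  have h2 : (2 * i + 1) / 2 = i := by omega
  rw [if_neg (by omega), if_pos h1, h2]

/-- `ω_{2i+2} = 1/(S nᵢ)`. -/
theorem ω_even (c i : ℕ) : ω⟦c, 2 * i + 2⟧ = 1 / ((S⟦c⟧ * n⟦c, i⟧ : ℕ) : ℝ) := by
  have h1 : ¬ (2 * i + 2) % 2 = 1 := by omega
  have h2 : (2 * i + 2) / 2 - 1 = i := by omega
  rw [if_neg (by omega), if_neg h1, h2]

/-- Every gap is `< 1`, so every weaving point is positive. -/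
theorem ω_lt_one (c j : ℕ) : ω⟦c, j⟧ < 1 := by
  have hS1 := one_le_S c
  obtain ⟨i, rfl | rfl⟩ := Nat.even_or_odd' j
  · rcases i with _ | i
    · norm_num
    · rw [show 2 * (i + 1) = 2 * i + 2 by ring, ω_even]
      have h2 : (2 : ℝ) ≤ ((S⟦c⟧ * n⟦c, i⟧ : ℕ) : ℝ) := by
        have : 2 ≤ S⟦c⟧ * n⟦c, i⟧ :=
          le_trans (le_trans (by omega) (S_ge c)) (Nat.le_mul_of_pos_right _ (one_le_n c i))
        exact_mod_cast this
      rw [div_lt_one (by linarith)]; linarith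
  · rw [ω_odd]
    have h1 : (1 : ℝ) ≤ (n⟦c, i⟧ : ℝ) := by exact_mod_cast one_le_n c i
    rw [div_lt_one (by linarith)]; linarith

/-- The gaps strictly decrease along the `2c + 1` weaving points: `ω_{j+1} < ω_j` for `j < 2c`. -/
theorem ω_succ_lt (c j : ℕ) (hj : j < 2 * c) : ω⟦c, j + 1⟧ < ω⟦c, j⟧ := by
  have hS := S_ge c
  have hS1 := one_le_S c
  have hSR : (64 : ℝ) ≤ (S⟦c⟧ : ℝ) := by
    have : 64 ≤ S⟦c⟧ := le_trans (by omega) hS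
    exact_mod_cast this
  obtain ⟨i, rfl | rfl⟩ := Nat.even_or_odd' j
  · -- `j = 2i`: from a valley (or from `1/2`) to the next peak
    rcases i with _ | i
    · -- `ω₁ = 1/(2n₀) < 1/2 = ω₀`
      rw [show 2 * 0 + 1 = 2 * 0 + 1 from rfl, ω_odd, show (2 * 0 : ℕ) = 0 from rfl, ω_zero]
      have h1 : (64 : ℝ) ≤ (n⟦c, 0⟧ : ℝ) := by
        have : 64 ≤ n⟦c, 0⟧ := le_trans (le_trans (by omega) hS) (S_le_n c 0)
        exact_mod_cast this
      apply one_div_lt_one_div_of_lt (by norm_num); linarith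
    · -- `ω_{2i+3} = 1/(2n_{i+1}) < 1/(S nᵢ) = ω_{2i+2}` since `n_{i+1} = S² nᵢ`
      rw [show 2 * (i + 1) + 1 = 2 * (i + 1) + 1 from rfl, ω_odd, show 2 * (i + 1) = 2 * i + 2 by ring, ω_even]
      have hn : (0 : ℝ) < (n⟦c, i⟧ : ℝ) := by exact_mod_cast one_le_n c i
      have hsucc : (n⟦c, i + 1⟧ : ℝ) = (S⟦c⟧ : ℝ) * ((S⟦c⟧ : ℝ) * (n⟦c, i⟧ : ℝ)) := by
        exact_mod_cast n_succ c i
      have hSn : (0 : ℝ) < (S⟦c⟧ : ℝ) * (n⟦c, i⟧ : ℝ) := by positivity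
      apply one_div_lt_one_div_of_lt (by positivity)
      rw [hsucc]; push_cast
      nlinarith [hSn, hSR]
  · -- `j = 2i+1`: from a peak to its valley, `1/(S nᵢ) < 1/(2nᵢ)`
    rw [show 2 * i + 1 + 1 = 2 * i + 2 by ring, ω_even, ω_odd]
    have hn : (0 : ℝ) < (n⟦c, i⟧ : ℝ) := by exact_mod_cast one_le_n c i
    apply one_div_lt_one_div_of_lt (by positivity)
    push_cast
    nlinarith [hn, hSR]

/-- Signs at the EVEN weaving points (the valley `1/2` and the valleys `1 − 1/(S nᵢ)`): negative. -/
theorem g_even_neg (c i : ℕ) : g⟦c⟧(1 - ω⟦c, 2 * i⟧) < 0 := by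
  rcases i with _ | i
  · rw [show (2 * 0 : ℕ) = 0 from rfl, ω_zero, show (1 : ℝ) - 1 / 2 = 1 / 2 by norm_num]
    exact g_half_neg c
  · rw [show 2 * (i + 1) = 2 * i + 2 by ring, ω_even]
    exact g_valley_neg c i

/-- Signs at the ODD weaving points (the peaks `1 − 1/(2nᵢ)`, `i < c`): positive. -/
theorem g_odd_pos (c i : ℕ) (hi : i < c) : 0 < g⟦c⟧(1 - ω⟦c, 2 * i + 1⟧) := by
  rw [ω_odd]; exact g_peak_pos c i hi

/-- Consecutive weaving points carry opposite signs. -/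
theorem g_alternates (c j : ℕ) (hj : j < 2 * c) :
    g⟦c⟧(1 - ω⟦c, j⟧) * g⟦c⟧(1 - ω⟦c, j + 1⟧) < 0 := by
  obtain ⟨i, rfl | rfl⟩ := Nat.even_or_odd' j
  · exact mul_neg_of_neg_of_pos (g_even_neg c i) (g_odd_pos c i (by omega))
  · rw [show 2 * i + 1 + 1 = 2 * (i + 1) by ring]
    exact mul_neg_of_pos_of_neg (g_odd_pos c i (by omega)) (g_even_neg c (i + 1))

end Summit.ValiantsHypothesis.ValiantsHypothesis.Theorems.LacunarySymmetroidMatrixDescartes.Pivot.PoleWeave
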